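/-
Copyright (c) 2026 the pub-hodgecm-mathlib formalisation cell (harness21).  Prover seat hodgecm-mathlib-K2Liu-p26 (g3), Track B «K2-LIT»,
#184♮ = hLiu418 = `stmt-HodgeConjecture-24832`; F4 (G-gen) road (E), the (E-d) see-saw pivot, input (R-grp) split (β) = (R-det):
THE THREE DETERMINANT LETTERS `hdet ∕ hxσ ∕ hx` OF ★ p863344 `K2LiuArchSWPivotOfRecord.swSection_junctionSlot_κOp_eq_vacScalar_mul`
for the right-leg partner datum `k̂ σ k = adelicSingle_{V′} (w σ) (…)` (F4 desk K2Liu-p27 (g2) 2026-09-04T23:59:52Z split ∕ deal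
2026-09-05T00:02:47Z; construction of `k̂` = K2E3-p31 (g2) ∕ K2E3-p25 (g4) `K2LiuArchPlaceSecJPartnerEmb`).
THEOREMS ONLY (no `def`, no `instance`, no notation, no named-fact hypothesis, no `sorry`); lane `--supports stmt-HodgeConjecture-24832 --as helper`.
-/
import Literature.NumberTheory.Automorphic.UnitaryGroupArchDet                  -- ★ `archDetInf`, `infiniteIdeles_archDetInf` (`(det_∞ k, 1) = det (k, 1)`)
import Literature.NumberTheory.Weil1964.ArchFollandDualPairDefinitePlaceSlice   -- ★ `toUFormEquiv`, `toUForm_toUFormEquiv_symm`, `det_coe_toUForm`, `UnitaryGroup.adelicSingle`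
import Literature.NumberTheory.Weil1964.ArchDualPairThetaMajorants             -- ★ `cmPlaceOver`
import HarnessLib

/-!
# Crux `HLiu418`, F4 (E-d) pivot, (R-det): the determinant of the one-place section `adelicSingle w g` is the `w`-single
# infinite idele of `det g`

Cell `hodgecm-mathlib`, crux item hLiu418 = `stmt-HodgeConjecture-24832` (helper lane `--supports`, count-neutral; closes no socket).

THE SOCKET.  ★ p863344 `K2LiuArchSWPivotOfRecord.swSection_junctionSlot_κOp_eq_vacScalar_mul` (the (E-d) see-saw pivot at the big CM
datum) quantifies the right-leg partner data `kk k ∈ U(V′)(𝔸_{L⁺})` abstractly, together with FOUR by-value letters about it: the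
group identity `hkk` ((R-grp) (α), K2E3-p25) and the three DETERMINANT letters (β)
* `hdet : GL.det ↑(kk k) = infiniteIdeles L (xx k)` for an explicit `xx k : (L ⊗ ℝ)ˣ`,
* `hxσ  : σ_{w(σ)} ((xx k)_{w(σ)}) = det c · det d` (`k = (c, d) ∈ U(R) × U(S)`),
* `hx   : σ_{w'} ((xx k)_{w'}) = 1` for every infinite place `w' ≠ w(σ)`,
consumed by ★ (R-scal) `K2LiuRightLegVacuumScalarMatch.chi_pow_infiniteIdeles_eq_etaD_mul_vacScalar`.  The partner datum of record
is the ONE-PLACE SECTION `kk k := adelicSingle_{V′} (cmPlaceOver L σ) g_k` of ★ `UnitaryGroupArchSection` (K2E3-p31 (g2)'s design,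
`K2LiuArchPlaceSecJPartnerEmb`: `g_k := (toUFormEquiv (signSplit y) _ one_ne_zero (formCongr_yFrame …)).symm (kV k)`), so the three
letters are FRAME-CHASE-FREE facts about `adelicSingle`, with the explicit witness
**`xx k := UnitaryGroup.archDetInf (UnitaryGroup.archSingle (cmPlaceOver L σ) g_k)`** (★ `UnitaryGroupArchDet`: `det_∞ k := (ringEquiv_mixedSpace)⁻¹ (det k)`):

* §1 (generic CM-type pair `E/F`, `c`, one complex place `w₁`): `extensionEmbedding_ringEquiv_mixedSpace_symm` (the complex coordinate
  of `(ringEquiv_mixedSpace E)⁻¹ y` at `w` is `y_w`); **`extensionEmbedding_archDetInf`** `σ_w (det_∞ k)_w = det (k_w)`;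
  **`det_adelicSingle`** `det (UnitaryGroup.adelicSingle w₁ g) = infiniteIdeles (det_∞ (UnitaryGroup.archSingle w₁ g))` (★ `infiniteIdeles_archDetInf`);
  **`extensionEmbedding_archDetInf_archSingle_self ∕ _of_ne ∕ _of_ne'`** (`= det g` at `w₁`, `= 1` at `w ≠ w₁`; ★ `archAt_archSingle_self ∕
  _of_ne`; the primed form runs over all infinite places of a totally complex `E`).
* §2 (sign frames): **`det_coe_toUFormEquiv_symm`** `det (toUFormEquiv⁻¹ kk) = det kk` (★ `det_coe_toUForm`); **`det_coe_kV`**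
  `det (kV (c,d)) = det c · det d`; **`det_coe_κ_snd`**.
* §3 (CM pin `F = L⁺`, `E = L`, `c` = complex conjugation, `w₁ = cmPlaceOver L σ`, any `H ∈ M_N(L)`, any Sylvester frame `hH` of `σ_{w(σ)} H`):
  the letters IN ★ p863344's BYTES — **`det_adelicSingle_cm`** (`hdet`), **`extensionEmbedding_xx_self_cm`** (`hxσ`, generic `g`),
  **`extensionEmbedding_xx_of_ne_cm`** (`hx`, all `w' ≠ (cmPlaceOver L σ).1`, `L` totally complex), **`extensionEmbedding_xx_self_kV`**
  (`hxσ` at `g := toUFormEquiv⁻¹ (kV k)`: `= det ↑k.1 * det ↑k.2`), and the bundle **`exists_det_letters_adelicSingle_kV`**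
  `∃ xx, (∀ k, hdet) ∧ (∀ k, hxσ) ∧ (∀ k w', w' ≠ w(σ) → hx)` for `kk k := UnitaryGroup.adelicSingle (cmPlaceOver L σ) (toUFormEquiv⁻¹ (kV k))`.
Default heartbeats (no CM sign frame of the big datum enters: `H`, the frame `(ε, D, c, hH)` and `σ` are abstract).
References: [BorelJacquet1979] §4.1 (`G(𝔸) = G_∞ × G(𝔸_f)`, `g ↦ (g, 1)`, `G_∞ = ∏_{v∣∞} G(F_v)`); [PlatonovRapinchuk1994] §2.3 (unitary
groups of hermitian forms, change of frame), §5.1 (adele groups); [KonnoKonno2007] §3.1 (3.1) (the compact dual pair `U(R) × U(S) ↪ U(R,S)`);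
[Mok2014] §1 Notation p. 5 (`det : U(N) → U(1)`).
HONEST LABEL: HC_CM is proved only modulo the 7 printed citations (2 remaining named inputs: hLiu418 = stmt-HodgeConjecture-24832,
h413 = stmt-HodgeConjecture-24833) until rung 0 closes; count-neutral helper, closes no socket.
-/

set_option autoImplicit false
set_option linter.dupNamespace false -- the mandated namespace repeats `HodgeConjecture.HodgeConjecture`

noncomputable section

open scoped Matrix
open NumberField NumberField.InfinitePlace NumberField.mixedEmbedding IsDedekindDomain
open Literature.NumberTheory.Automorphic Literature.NumberTheory.Automorphic.UnitaryGroup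
open Literature.NumberTheory.GaloisRepresentations (infiniteIdeles)
open Literature.NumberTheory.Weil1964
open Literature.Analysis.SegalBargmann (DPK)
open Literature.RepresentationTheory.KonnoKonno2007 Literature.RepresentationTheory.KonnoKonno2007.RealDualPair

namespace Summit.HodgeConjecture.HodgeConjecture.Cruxes.HLiu418.K2LiuArchPlaceSecDet

/-! ## §1 Generic: the determinant of an archimedean element of `U(J)`, place by place, and of the one-place section -/

section Generic

variable (F E : Type) [Field F] [NumberField F] [Field E] [NumberField E] [Algebra F E]
  (c : E ≃ₐ[F] E) (N : ℕ) (J : Matrix (Fin N) (Fin N) E)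
  (hc : c ≠ 1) (hfix : ∀ w : InfinitePlace E, c • w = w)

omit [NumberField E] in
/-- The complex coordinate at a complex place `w` of `(ringEquiv_mixedSpace E)⁻¹ y ∈ E_∞ = ∏_v E_v` is `y_w`:
`σ_w (((ringEquiv_mixedSpace E)⁻¹ y)_w) = y.2 w` (Mathlib's `ringEquiv_mixedSpace_apply`, read backwards). [folklore] -/
theorem extensionEmbedding_ringEquiv_mixedSpace_symm (y : mixedSpace E) (w : {w : InfinitePlace E // IsComplex w}) :
    InfinitePlace.Completion.extensionEmbedding w.1 (((InfiniteAdeleRing.ringEquiv_mixedSpace E).symm y) w.1) = y.2 w :=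
  calc InfinitePlace.Completion.extensionEmbedding w.1 (((InfiniteAdeleRing.ringEquiv_mixedSpace E).symm y) w.1)
      = ((InfiniteAdeleRing.ringEquiv_mixedSpace E) ((InfiniteAdeleRing.ringEquiv_mixedSpace E).symm y)).2 w := rfl
    _ = y.2 w := by rw [RingEquiv.apply_symm_apply]

omit [NumberField F] [NumberField E] in
/-- **`σ_w ((det_∞ k)_w) = det (k_w)`**: at a complex place `w` (fixed by `c ≠ 1`) the `w`-coordinate of the archimedean determinant
`det_∞ k = (ringEquiv_mixedSpace E)⁻¹ (det k) ∈ (E_∞)ˣ` of `k ∈ U(J)(E ⊗ ℝ)` is the determinant of the local component `k_w = UnitaryGroup.archAt w k ∈ U(σ_w J)(ℂ)`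
(`det` commutes with the coordinate ring homomorphism `evalC w`). [cite: BorelJacquet1979, §4.1] -/
theorem extensionEmbedding_archDetInf (k : UnitaryGroup.arch F E c N J) (w : {w : InfinitePlace E // IsComplex w}) :
    InfinitePlace.Completion.extensionEmbedding w.1 ((UnitaryGroup.archDetInf F E c N J k : InfiniteAdeleRing E) w.1) =
      ((((UnitaryGroup.archAt F E c N J w (hfix w.1) hc k : UnitaryGroup.archLocal E N J w) : GL (Fin N) ℂ) : Matrix (Fin N) (Fin N) ℂ)).det := by
  rw [coe_archDetInf, extensionEmbedding_ringEquiv_mixedSpace_symm, ← evalC_apply, RingHom.map_det]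
  rfl

/-- **`det (UnitaryGroup.adelicSingle w₁ g) = (det_∞ (UnitaryGroup.archSingle w₁ g), 1)`** in `𝔸_Eˣ`: the determinant of the one-place section
`adelicSingle w₁ g = ((g at w₁, 1 elsewhere), 1_f) ∈ U(J)(𝔸_F)` is the infinite idele of the archimedean determinant of `archSingle w₁ g`
(★ `infiniteIdeles_archDetInf`, `adelicSingle = archToAdelic ∘ archSingle`). [cite: BorelJacquet1979, §4.1] -/
theorem det_adelicSingle (w₁ : {w : InfinitePlace E // IsComplex w}) (g : UnitaryGroup.archLocal E N J w₁) :
    Matrix.GeneralLinearGroup.det (Subtype.val (UnitaryGroup.adelicSingle F E c N J hc hfix w₁ g)) =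
      infiniteIdeles E (UnitaryGroup.archDetInf F E c N J (UnitaryGroup.archSingle F E c N J hc hfix w₁ g)) :=
  (infiniteIdeles_archDetInf F E c N J (UnitaryGroup.archSingle F E c N J hc hfix w₁ g)).symm

omit [NumberField F] [NumberField E] in
/-- **At the place `w₁`: `σ_{w₁} ((det_∞ (UnitaryGroup.archSingle w₁ g))_{w₁}) = det g`** (`(UnitaryGroup.archSingle w₁ g)_{w₁} = g`, ★ `archAt_archSingle_self`).
[cite: BorelJacquet1979, §4.1] -/
theorem extensionEmbedding_archDetInf_archSingle_self (w₁ : {w : InfinitePlace E // IsComplex w}) (g : UnitaryGroup.archLocal E N J w₁) :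
    InfinitePlace.Completion.extensionEmbedding w₁.1
        ((UnitaryGroup.archDetInf F E c N J (UnitaryGroup.archSingle F E c N J hc hfix w₁ g) : InfiniteAdeleRing E) w₁.1) =
      (((g : UnitaryGroup.archLocal E N J w₁) : GL (Fin N) ℂ) : Matrix (Fin N) (Fin N) ℂ).det := by
  rw [extensionEmbedding_archDetInf F E c N J hc hfix, archAt_archSingle_self]

omit [NumberField F] [NumberField E] in
/-- **Off the place `w₁`: `σ_w ((det_∞ (UnitaryGroup.archSingle w₁ g))_w) = 1`** for a complex place `w ≠ w₁` (`(UnitaryGroup.archSingle w₁ g)_w = 1`,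
★ `archAt_archSingle_of_ne`). [cite: BorelJacquet1979, §4.1] -/
theorem extensionEmbedding_archDetInf_archSingle_of_ne (w₁ : {w : InfinitePlace E // IsComplex w}) (g : UnitaryGroup.archLocal E N J w₁)
    {w : {w : InfinitePlace E // IsComplex w}} (hw : w ≠ w₁) :
    InfinitePlace.Completion.extensionEmbedding w.1
        ((UnitaryGroup.archDetInf F E c N J (UnitaryGroup.archSingle F E c N J hc hfix w₁ g) : InfiniteAdeleRing E) w.1) = 1 := by
  rw [extensionEmbedding_archDetInf F E c N J hc hfix, archAt_archSingle_of_ne F E c N J hc hfix w₁ hw, OneMemClass.coe_one,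
    Units.val_one, Matrix.det_one]

omit [NumberField F] [NumberField E] in
/-- the same over ALL infinite places `w ≠ w₁` of a totally complex `E` (every infinite place is complex). [cite: BorelJacquet1979, §4.1] -/
theorem extensionEmbedding_archDetInf_archSingle_of_ne' [IsTotallyComplex E] (w₁ : {w : InfinitePlace E // IsComplex w})
    (g : UnitaryGroup.archLocal E N J w₁) (w : InfinitePlace E) (hw : w ≠ w₁.1) :
    InfinitePlace.Completion.extensionEmbedding w
        ((UnitaryGroup.archDetInf F E c N J (UnitaryGroup.archSingle F E c N J hc hfix w₁ g) : InfiniteAdeleRing E) w) = 1 :=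
  extensionEmbedding_archDetInf_archSingle_of_ne F E c N J hc hfix w₁ g (w := ⟨w, IsTotallyComplex.isComplex w⟩)
    fun h => hw (congrArg Subtype.val h)

end Generic

/-! ## §2 Determinants in the sign frames: `toUFormEquiv⁻¹`, `kV`, `κ` -/

section Frames

variable {n : Type} [Fintype n] [DecidableEq n] {R S : Type} [Fintype R] [DecidableEq R] [Fintype S] [DecidableEq S]

/-- **`det (toUFormEquiv⁻¹ kk) = det kk`**: placing `U(R,S)` back in the frame of `H` (inverse of weil-2's `toUForm`: conjugation by the
Sylvester datum and sorting by the sign frame) does not change the determinant (★ `det_coe_toUForm` at `toUFormEquiv⁻¹ kk`,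
★ `toUForm_toUFormEquiv_symm`). [cite: PlatonovRapinchuk1994, §2.3] -/
theorem det_coe_toUFormEquiv_symm (ε : n ≃ R ⊕ S) {D : n → ℝ} (hD0 : ∀ j, D j ≠ 0) {c : ℝ} (hc : c ≠ 0) {Hc : Matrix n n ℂ}
    (hH : formCongr (starRingEnd ℂ) (scaleGL D hD0) (((c : ℂ) • signForm R S).submatrix ε ε) = Hc) (kk : UForm R S) :
    ((((toUFormEquiv ε hD0 hc hH).symm kk : unitaryGroupOfForm (starRingEnd ℂ) Hc) : GL n ℂ) : Matrix n n ℂ).det =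
      (((kk : UForm R S) : GL (R ⊕ S) ℂ) : Matrix (R ⊕ S) (R ⊕ S) ℂ).det := by
  rw [← det_coe_toUForm ε hD0 hc hH ((toUFormEquiv ε hD0 hc hH).symm kk), toUForm_toUFormEquiv_symm]

/-- **`det (kV (c, d)) = det c · det d`** for the maximal compact `U(R) × U(S) →* U(R,S)`, `(c,d) ↦ diag(c,d)` (★ `UForm.coe_kV`).
[cite: KonnoKonno2007, §3.1 (3.1)] -/
theorem det_coe_kV (k : Matrix.unitaryGroup R ℂ × Matrix.unitaryGroup S ℂ) :
    (((UForm.kV R S k : UForm R S) : GL (R ⊕ S) ℂ) : Matrix (R ⊕ S) (R ⊕ S) ℂ).det =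
      (k.1 : Matrix R R ℂ).det * (k.2 : Matrix S S ℂ).det := by
  rw [UForm.coe_kV, Matrix.det_fromBlocks_zero₂₁]

/-- `det` of the second component of the compact datum `κ k = (kV (a,b), kV (c,d))` of the dual pair: `det c · det d` (★ `coe_κ_snd`).
[cite: KonnoKonno2007, §3.1 (3.1)] -/
theorem det_coe_κ_snd {P Q : Type} [Fintype P] [DecidableEq P] [Fintype Q] [DecidableEq Q] (k : DPK P Q R S) :
    ((((κ P Q R S k).2 : UForm R S) : GL (R ⊕ S) ℂ) : Matrix (R ⊕ S) (R ⊕ S) ℂ).det =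
      (k.2.1 : Matrix R R ℂ).det * (k.2.2 : Matrix S S ℂ).det := by
  rw [coe_κ_snd, Matrix.det_fromBlocks_zero₂₁]

end Frames

/-! ## §3 The CM pin: the three determinant letters `hdet ∕ hxσ ∕ hx` of ★ p863344 for `kk := UnitaryGroup.adelicSingle (cmPlaceOver L σ) g` -/

section CM

variable (L : Type) [Field L] [NumberField L] [IsCMField L] (N : ℕ) (H : Matrix (Fin N) (Fin N) L)
  (σ : {v : InfinitePlace ↥(maximalRealSubfield L) // v.IsReal})

/-- **(R-det) `hdet`**: for `g ∈ U(σ_{w(σ)} H)(ℂ)`, `det (UnitaryGroup.adelicSingle (cmPlaceOver L σ) g) = infiniteIdeles L (xx g)` in `GL_1(𝔸_L)`, with the explicit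
witness `xx g := UnitaryGroup.archDetInf (UnitaryGroup.archSingle (cmPlaceOver L σ) g) ∈ (L ⊗ ℝ)ˣ` — ★ p863344's binder `hdet` for the partner datum of record
(§1 `det_adelicSingle` at the CM pin `F = L⁺`, `E = L`, `c` = complex conjugation). [cite: BorelJacquet1979, §4.1] [cite: Mok2014, §1 Notation p. 5] -/
theorem det_adelicSingle_cm (g : UnitaryGroup.archLocal L N H (cmPlaceOver L σ)) :
    Matrix.GeneralLinearGroup.det
        (Subtype.val (UnitaryGroup.adelicSingle (↥(maximalRealSubfield L)) L (IsCMField.complexConj L) N H (IsCMField.complexConj_ne_one L)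
            (complexConj_smul_infinitePlace L) (cmPlaceOver L σ) g)) =
      infiniteIdeles L
        (UnitaryGroup.archDetInf (↥(maximalRealSubfield L)) L (IsCMField.complexConj L) N H
          (UnitaryGroup.archSingle (↥(maximalRealSubfield L)) L (IsCMField.complexConj L) N H (IsCMField.complexConj_ne_one L)
            (complexConj_smul_infinitePlace L) (cmPlaceOver L σ) g)) :=
  det_adelicSingle _ L _ N H _ _ _ g

/-- **(R-det) `hxσ`, generic `g`**: `σ_{w(σ)} ((xx g)_{w(σ)}) = det g` for `xx g := UnitaryGroup.archDetInf (UnitaryGroup.archSingle (cmPlaceOver L σ) g)`.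
[cite: BorelJacquet1979, §4.1] -/
theorem extensionEmbedding_xx_self_cm (g : UnitaryGroup.archLocal L N H (cmPlaceOver L σ)) :
    InfinitePlace.Completion.extensionEmbedding (cmPlaceOver L σ).1
        ((UnitaryGroup.archDetInf (↥(maximalRealSubfield L)) L (IsCMField.complexConj L) N H
            (UnitaryGroup.archSingle (↥(maximalRealSubfield L)) L (IsCMField.complexConj L) N H (IsCMField.complexConj_ne_one L)
              (complexConj_smul_infinitePlace L) (cmPlaceOver L σ) g) : InfiniteAdeleRing L) (cmPlaceOver L σ).1) =
      (((g : UnitaryGroup.archLocal L N H (cmPlaceOver L σ)) : GL (Fin N) ℂ) : Matrix (Fin N) (Fin N) ℂ).det :=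
  extensionEmbedding_archDetInf_archSingle_self _ L _ N H _ _ _ g

/-- **(R-det) `hx`**: `σ_{w'} ((xx g)_{w'}) = 1` for EVERY infinite place `w' ≠ (cmPlaceOver L σ).1` of the CM field `L` (all its infinite places
are complex) — ★ p863344's binder `hx`. [cite: BorelJacquet1979, §4.1] -/
theorem extensionEmbedding_xx_of_ne_cm (g : UnitaryGroup.archLocal L N H (cmPlaceOver L σ)) (w : InfinitePlace L) (hw : w ≠ (cmPlaceOver L σ).1) :
    InfinitePlace.Completion.extensionEmbedding w
        ((UnitaryGroup.archDetInf (↥(maximalRealSubfield L)) L (IsCMField.complexConj L) N H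
            (UnitaryGroup.archSingle (↥(maximalRealSubfield L)) L (IsCMField.complexConj L) N H (IsCMField.complexConj_ne_one L)
              (complexConj_smul_infinitePlace L) (cmPlaceOver L σ) g) : InfiniteAdeleRing L) w) = 1 :=
  extensionEmbedding_archDetInf_archSingle_of_ne' _ L _ N H _ _ _ g w hw

variable {R S : Type} [Fintype R] [DecidableEq R] [Fintype S] [DecidableEq S]
  (ε : Fin N ≃ R ⊕ S) {D : Fin N → ℝ} (hD0 : ∀ j, D j ≠ 0) {c : ℝ} (hc : c ≠ 0)
  (hH : formCongr (starRingEnd ℂ) (scaleGL D hD0) (((c : ℂ) • signForm R S).submatrix ε ε) = H.map (cmPlaceOver L σ).1.embedding)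

/-- **(R-det) `hxσ` in a sign frame, generic `kk ∈ U(R,S)`**: for `g := toUFormEquiv⁻¹ kk` (any Sylvester frame `hH` of `σ_{w(σ)} H`),
`σ_{w(σ)} ((xx g)_{w(σ)}) = det kk` (§3 `extensionEmbedding_xx_self_cm` + §2 `det_coe_toUFormEquiv_symm`).
[cite: PlatonovRapinchuk1994, §2.3] [cite: BorelJacquet1979, §4.1] -/
theorem extensionEmbedding_xx_self_toUFormEquiv_symm (kk : UForm R S) :
    InfinitePlace.Completion.extensionEmbedding (cmPlaceOver L σ).1
        ((UnitaryGroup.archDetInf (↥(maximalRealSubfield L)) L (IsCMField.complexConj L) N H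
            (UnitaryGroup.archSingle (↥(maximalRealSubfield L)) L (IsCMField.complexConj L) N H (IsCMField.complexConj_ne_one L)
              (complexConj_smul_infinitePlace L) (cmPlaceOver L σ) ((toUFormEquiv ε hD0 hc hH).symm kk)) : InfiniteAdeleRing L)
          (cmPlaceOver L σ).1) =
      (((kk : UForm R S) : GL (R ⊕ S) ℂ) : Matrix (R ⊕ S) (R ⊕ S) ℂ).det := by
  rw [extensionEmbedding_xx_self_cm, det_coe_toUFormEquiv_symm]

/-- **(R-det) `hxσ` AT THE COMPACT DATUM — ★ p863344's binder `hxσ` verbatim**: for `k = (c, d) ∈ U(R) × U(S)` and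
`g := toUFormEquiv⁻¹ (kV k)`, `σ_{w(σ)} ((xx g)_{w(σ)}) = det ↑k.1 * det ↑k.2` (§2 `det_coe_kV`).
[cite: KonnoKonno2007, §3.1 (3.1)] [cite: BorelJacquet1979, §4.1] -/
theorem extensionEmbedding_xx_self_kV (k : Matrix.unitaryGroup R ℂ × Matrix.unitaryGroup S ℂ) :
    InfinitePlace.Completion.extensionEmbedding (cmPlaceOver L σ).1
        ((UnitaryGroup.archDetInf (↥(maximalRealSubfield L)) L (IsCMField.complexConj L) N H
            (UnitaryGroup.archSingle (↥(maximalRealSubfield L)) L (IsCMField.complexConj L) N H (IsCMField.complexConj_ne_one L)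
              (complexConj_smul_infinitePlace L) (cmPlaceOver L σ) ((toUFormEquiv ε hD0 hc hH).symm (UForm.kV R S k))) :
            InfiniteAdeleRing L) (cmPlaceOver L σ).1) =
      (k.1 : Matrix R R ℂ).det * (k.2 : Matrix S S ℂ).det := by
  rw [extensionEmbedding_xx_self_toUFormEquiv_symm, det_coe_kV]

/-- **(R-det) — THE THREE DETERMINANT LETTERS OF ★ p863344, BUNDLED**: for the partner datum of record
`kk k := UnitaryGroup.adelicSingle (cmPlaceOver L σ) (toUFormEquiv⁻¹ (kV k))`, `k ∈ U(R) × U(S)` (K2E3-p31 ∕ K2E3-p25's `k̂ σ k`, any hermitian `H`, any Sylvester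
frame `hH` of `σ_{w(σ)} H`), there is an explicit `xx : U(R) × U(S) → (L ⊗ ℝ)ˣ` (namely `xx k = UnitaryGroup.archDetInf (UnitaryGroup.archSingle (cmPlaceOver L σ) (toUFormEquiv⁻¹ (kV k)))`)
with `hdet`, `hxσ`, `hx` in the consumer's bytes. [cite: BorelJacquet1979, §4.1] [cite: KonnoKonno2007, §3.1 (3.1)] [cite: Mok2014, §1 Notation p. 5] -/
theorem exists_det_letters_adelicSingle_kV :
    ∃ xx : Matrix.unitaryGroup R ℂ × Matrix.unitaryGroup S ℂ → (InfiniteAdeleRing L)ˣ,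
      (∀ k : Matrix.unitaryGroup R ℂ × Matrix.unitaryGroup S ℂ,
        Matrix.GeneralLinearGroup.det
            (Subtype.val (UnitaryGroup.adelicSingle (↥(maximalRealSubfield L)) L (IsCMField.complexConj L) N H (IsCMField.complexConj_ne_one L)
                (complexConj_smul_infinitePlace L) (cmPlaceOver L σ) ((toUFormEquiv ε hD0 hc hH).symm (UForm.kV R S k)))) =
          infiniteIdeles L (xx k)) ∧
      (∀ k : Matrix.unitaryGroup R ℂ × Matrix.unitaryGroup S ℂ,
        InfinitePlace.Completion.extensionEmbedding (cmPlaceOver L σ).1 ((xx k : InfiniteAdeleRing L) (cmPlaceOver L σ).1) =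
          (k.1 : Matrix R R ℂ).det * (k.2 : Matrix S S ℂ).det) ∧
      (∀ (k : Matrix.unitaryGroup R ℂ × Matrix.unitaryGroup S ℂ) (w : InfinitePlace L), w ≠ (cmPlaceOver L σ).1 →
        InfinitePlace.Completion.extensionEmbedding w ((xx k : InfiniteAdeleRing L) w) = 1) :=
  ⟨fun k => UnitaryGroup.archDetInf (↥(maximalRealSubfield L)) L (IsCMField.complexConj L) N H
      (UnitaryGroup.archSingle (↥(maximalRealSubfield L)) L (IsCMField.complexConj L) N H (IsCMField.complexConj_ne_one L)
        (complexConj_smul_infinitePlace L) (cmPlaceOver L σ) ((toUFormEquiv ε hD0 hc hH).symm (UForm.kV R S k))),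
    fun _ => det_adelicSingle_cm L N H σ _,
    fun k => extensionEmbedding_xx_self_kV L N H σ ε hD0 hc hH k,
    fun _ w hw => extensionEmbedding_xx_of_ne_cm L N H σ _ w hw⟩

end CM

end Summit.HodgeConjecture.HodgeConjecture.Cruxes.HLiu418.K2LiuArchPlaceSecDet

end
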